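import Mathlib
import HarnessLib
import Summits.HubbardSuperconductivity.HubbardSuperconductivity.Theorems.KLProgrammeC4aFoldCurvaturePartnerBand
import Summits.HubbardSuperconductivity.HubbardSuperconductivity.Theorems.KLProgrammeC4aFoldLevelSets
import Summits.HubbardSuperconductivity.HubbardSuperconductivity.Theorems.KLProgrammeC4aFoldSubstitution

/-!
# Route `KLProgramme` — crux C4a, S3 (B4)-(T) — FOLD-WINDOW CALCULUS, the SHARP INSTANCE («(B4)-TAN-FOLD», part 6): on a tangency window `|φ| ≤ φ₀` with
# `L(φ₀) ≤ (3/200)·u_min²` the pp/ph partner band is a `C²` fold with floor `b = (3/400)·u_min²`; its level sets of width `y₂ − y₁` have loop-angle measure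
# `≤ 2√((y₂ − y₁)/b)`, and `‖∫ w φ • Ψ(ē φ) dφ‖ ≤ W·(2√b)⁻¹·(∫ + ∫) ‖Ψ y‖ (y − ē_min)^{−1/2} dy` — parts 2–3 BY NAME

Cell `gate-hubbard-kl`, seat hubbard-kl-k3c3-p3 (g21; row «implicit-function / monotonicity route»); helper for stub (C) `stub_twoLeg_curvature` of the
engine-flow child `KLRegimeEngineV17F2` (stmt-HubbardSuperconductivity-20437); memo HOME/hubbard-kl-c4a-1/C4A-PLAN.md §24.2 (the square-root law at (T)), §24.4, §24.9;
memo HOME/hubbard-kl-k3c3-p3/B4-TAN-FOLD.md §2 «SHARP (level form)».  Composition of `…C4aFoldCurvaturePartnerBand.iteratedDeriv_two_partnerBand_pp/ph_angle_ge`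
(curvature floor `(3/100)u_min² − L`) with `…C4aFoldLevelSets` / `…C4aFoldSubstitution` (the C² fold at floor `2b`):

* **`partnerBand_pp_fold_conv`** / **`_ph_`** — with `L(φ₀, e, ρ, ϑ) ≤ (3/200)·u_min²`: `2·((3/400)·u_min²) ≤ ∂_φ² ē(φ)` for every `|φ| ≤ φ₀` (`L` is monotone in `|φ|`);
* **`volume_levelSet_pp_tangency_le`** / **`_ph_`** — `vol {φ ∈ [−φ₀, φ₀] : ē(φ) ∈ [y₁, y₂]} ≤ 2·√((y₂ − y₁)/((3/400)·u_min²))` for `y₁ ≤ y₂`: a partner shell of level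
  width `2ε` meets the tangency window in loop-angle measure `≤ 2√(2ε/b)` WHATEVER its position relative to the fold value (the uniform square-root law; the
  value form of part 4 needs `ε + η` in the root, this one does not);
* **`norm_intervalIntegral_smul_partnerBand_pp_tangency_le_level`** / **`_ph_`** — for `|w| ≤ W` on the window and continuous `Ψ : ℝ → E` there is a minimiser
  `c` of `ē` on `[−φ₀, φ₀]` with `‖∫_{−φ₀..φ₀} w φ • Ψ(ē φ) dφ‖ ≤ W·(2√b)⁻¹·(∫_{ē c..ē(−φ₀)} + ∫_{ē c..ē φ₀}) ‖Ψ y‖·(y − ē c)^{−1/2} dy`.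

Hypotheses = those of `…C4aPartnerBandTangencyLower` + `FrameOK R U N μ K`.  Bookkeeping on landed objects; nothing about the model's sizes; nothing asserts
superconductivity.  References: FST II CPAM 51 (1998) Lemma 2.1, §3 [cite: FeldmanSalmhoferTrubowitz1998]; BGM 2006 §2.4 (2.40) [cite: BenfattoGiulianiMastropietro2006].
-/

noncomputable section

namespace Summit.HubbardSuperconductivity.HubbardSuperconductivity.Theorems.C4a

set_option linter.dupNamespace false -- summit = problem name (single-conjunct summit), D-0017

open Real Set Filter MeasureTheory
open scoped Topology ENNReal
open Literature.MathematicalPhysics.QuantumLattice Literature.MathematicalPhysics.QuantumLattice.BandSectorCounting Literature.Probability.LatticeModels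
open Summit.HubbardSuperconductivity.HubbardSuperconductivity.Theorems.KLRegimeSplit
open Summit.HubbardSuperconductivity.HubbardSuperconductivity.Theorems.DispersionFlow
open Summit.HubbardSuperconductivity.HubbardSuperconductivity.Theorems.PerturbedFermiCurve

variable {E : Type*} [NormedAddCommGroup E] [NormedSpace ℝ E]

section Sizes

variable {K : TrigPolyC4v} {A : ℝ} (hA : ∀ p : Momentum, ∀ j ≤ 2, ‖iteratedFDeriv ℝ j (frameShift K) p‖ ≤ A) (hA20 : A ≤ 1 / 20)
  (hd : klCurveD ≤ (bandBounds (show (-4 : ℝ) < -1.1 by norm_num) (show (-1.1 : ℝ) ≤ -0.1 by norm_num)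
    (show (-0.1 : ℝ) < 0 by norm_num)).Dtmin - 2 * A)
  {μ r : ℝ} (hr : 0 < r) (hlo : (-1.1 : ℝ) < μ - r - A) (hhi : μ + r + A < -0.1)
  {A₃ A₄ : ℝ} (hA₃ : ∀ p : Momentum, ‖iteratedFDeriv ℝ 3 (frameShift K) p‖ ≤ A₃)
  (hA₄ : ∀ p : Momentum, ‖iteratedFDeriv ℝ 4 (frameShift K) p‖ ≤ A₄)
  {K₁ K₂ K₃ : ℝ} (hK₁ : ∀ p : Momentum, ‖fderiv ℝ (frameLevel μ K) p‖ ≤ K₁) (hK₂ : ∀ p : Momentum, ‖iteratedFDeriv ℝ 2 (frameLevel μ K) p‖ ≤ K₂)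
  (hK₃ : ∀ p : Momentum, ‖iteratedFDeriv ℝ 3 (frameLevel μ K) p‖ ≤ K₃)
include hA hA20 hd hr hlo hhi hA₃ hA₄ hK₁ hK₂ hK₃

omit hr in
/-- The error `L` of the curvature floor is monotone in the loop angle: `L(|t|) ≤ L(φ₀)` for `|t| ≤ φ₀` (all coefficients of `|φ|` are nonnegative). -/
theorem curvFloorErr_mono {δ₀ φ₀ t : ℝ} (ht : |t| ≤ φ₀) {e : ℝ} (he : |e| < r) :
    K₃ * (δ₀ + |e| / ((bandBounds (show (-4 : ℝ) < -1.1 by norm_num) (show (-1.1 : ℝ) ≤ -0.1 by norm_num) (show (-0.1 : ℝ) < 0 by norm_num)).Dtmin - 2 * A) +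
            msD A₃ A₄ 1 * |t|) * msD A₃ A₄ 1 ^ 2 +
        K₂ * (radialRowOneConst A ((bandBounds (show (-4 : ℝ) < -1.1 by norm_num) (show (-1.1 : ℝ) ≤ -0.1 by norm_num) (show (-0.1 : ℝ) < 0 by norm_num)).Dtmin - 2 * A) * |e| +
            msD A₃ A₄ 2 * |t|) * (msD A₃ A₄ 1 + msD A₃ A₄ 1) +
        K₂ * (δ₀ + |e| / ((bandBounds (show (-4 : ℝ) < -1.1 by norm_num) (show (-1.1 : ℝ) ≤ -0.1 by norm_num) (show (-0.1 : ℝ) < 0 by norm_num)).Dtmin - 2 * A) +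
            msD A₃ A₄ 1 * |t|) * msD A₃ A₄ 2 +
        K₁ * ((uRowTwoConst A A₃ ((bandBounds (show (-4 : ℝ) < -1.1 by norm_num) (show (-1.1 : ℝ) ≤ -0.1 by norm_num) (show (-0.1 : ℝ) < 0 by norm_num)).Dtmin - 2 * A) +
              1 / ((bandBounds (show (-4 : ℝ) < -1.1 by norm_num) (show (-1.1 : ℝ) ≤ -0.1 by norm_num) (show (-0.1 : ℝ) < 0 by norm_num)).Dtmin - 2 * A) +
              2 * (radialRowOneConst A ((bandBounds (show (-4 : ℝ) < -1.1 by norm_num) (show (-1.1 : ℝ) ≤ -0.1 by norm_num) (show (-0.1 : ℝ) < 0 by norm_num)).Dtmin - 2 * A) -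
                1 / ((bandBounds (show (-4 : ℝ) < -1.1 by norm_num) (show (-1.1 : ℝ) ≤ -0.1 by norm_num) (show (-0.1 : ℝ) < 0 by norm_num)).Dtmin - 2 * A))) * |e| +
            msD A₃ A₄ 3 * |t|) ≤
    K₃ * (δ₀ + |e| / ((bandBounds (show (-4 : ℝ) < -1.1 by norm_num) (show (-1.1 : ℝ) ≤ -0.1 by norm_num) (show (-0.1 : ℝ) < 0 by norm_num)).Dtmin - 2 * A) +
            msD A₃ A₄ 1 * φ₀) * msD A₃ A₄ 1 ^ 2 +
        K₂ * (radialRowOneConst A ((bandBounds (show (-4 : ℝ) < -1.1 by norm_num) (show (-1.1 : ℝ) ≤ -0.1 by norm_num) (show (-0.1 : ℝ) < 0 by norm_num)).Dtmin - 2 * A) * |e| +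
            msD A₃ A₄ 2 * φ₀) * (msD A₃ A₄ 1 + msD A₃ A₄ 1) +
        K₂ * (δ₀ + |e| / ((bandBounds (show (-4 : ℝ) < -1.1 by norm_num) (show (-1.1 : ℝ) ≤ -0.1 by norm_num) (show (-0.1 : ℝ) < 0 by norm_num)).Dtmin - 2 * A) +
            msD A₃ A₄ 1 * φ₀) * msD A₃ A₄ 2 +
        K₁ * ((uRowTwoConst A A₃ ((bandBounds (show (-4 : ℝ) < -1.1 by norm_num) (show (-1.1 : ℝ) ≤ -0.1 by norm_num) (show (-0.1 : ℝ) < 0 by norm_num)).Dtmin - 2 * A) +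
              1 / ((bandBounds (show (-4 : ℝ) < -1.1 by norm_num) (show (-1.1 : ℝ) ≤ -0.1 by norm_num) (show (-0.1 : ℝ) < 0 by norm_num)).Dtmin - 2 * A) +
              2 * (radialRowOneConst A ((bandBounds (show (-4 : ℝ) < -1.1 by norm_num) (show (-1.1 : ℝ) ≤ -0.1 by norm_num) (show (-0.1 : ℝ) < 0 by norm_num)).Dtmin - 2 * A) -
                1 / ((bandBounds (show (-4 : ℝ) < -1.1 by norm_num) (show (-1.1 : ℝ) ≤ -0.1 by norm_num) (show (-0.1 : ℝ) < 0 by norm_num)).Dtmin - 2 * A))) * |e| +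
            msD A₃ A₄ 3 * φ₀) := by
  have hK₁0 : 0 ≤ K₁ := (norm_nonneg _).trans (hK₁ 0)
  have hK₂0 : 0 ≤ K₂ := (norm_nonneg _).trans (hK₂ 0)
  have hK₃0 : 0 ≤ K₃ := (norm_nonneg _).trans (hK₃ 0)
  have hD1 := fun s => norm_iteratedDeriv_levelPoint_le hA hA20 hd hlo hhi hA₃ hA₄ he le_rfl (by norm_num) s
  have hD2 := fun s => norm_iteratedDeriv_levelPoint_le hA hA20 hd hlo hhi hA₃ hA₄ he (i := 2) (by norm_num) (by norm_num) s
  have hD3 := fun s => norm_iteratedDeriv_levelPoint_le hA hA20 hd hlo hhi hA₃ hA₄ he (i := 3) (by norm_num) (by norm_num) s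
  have hD10 : 0 ≤ msD A₃ A₄ 1 := (norm_nonneg _).trans (hD1 0)
  have hD20 : 0 ≤ msD A₃ A₄ 2 := (norm_nonneg _).trans (hD2 0)
  have hD30 : 0 ≤ msD A₃ A₄ 3 := (norm_nonneg _).trans (hD3 0)
  have hdt : 0 ≤ φ₀ - |t| := sub_nonneg.2 ht
  have h1 : 0 ≤ K₃ * (msD A₃ A₄ 1 * (φ₀ - |t|)) * msD A₃ A₄ 1 ^ 2 := by positivity
  have h2 : 0 ≤ K₂ * (msD A₃ A₄ 2 * (φ₀ - |t|)) * (msD A₃ A₄ 1 + msD A₃ A₄ 1) := by positivity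
  have h3 : 0 ≤ K₂ * (msD A₃ A₄ 1 * (φ₀ - |t|)) * msD A₃ A₄ 2 := by positivity
  have h4 : 0 ≤ K₁ * (msD A₃ A₄ 3 * (φ₀ - |t|)) := by positivity
  nlinarith [h1, h2, h3, h4]

/-- **THE pp PARTNER BAND IS A C² FOLD ON THE TANGENCY WINDOW**: under `FrameOK`, for `|ρ| < r`, `|e| < r` and a window `φ₀` with
`L(φ₀, e, ρ, |ϑ|) ≤ (3/200)·u_min²`: `2·((3/400)·u_min²) ≤ ∂_φ² e_K(S_{ρϑθ}(0) − Φ(e, φ+θ))` for every `φ ∈ [−φ₀, φ₀]`. -/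
theorem partnerBand_pp_fold_conv {R : RenConsts} {U : ℝ} {N : ℕ} (hF : FrameOK R U N μ K) {ρ : ℝ} (hρ : |ρ| < r) {e : ℝ} (he : |e| < r) (ϑ θ : ℝ) {φ₀ : ℝ}
    (hwin : K₃ * (|ρ| / ((bandBounds (show (-4 : ℝ) < -1.1 by norm_num) (show (-1.1 : ℝ) ≤ -0.1 by norm_num) (show (-0.1 : ℝ) < 0 by norm_num)).Dtmin - 2 * A) +
              msD A₃ A₄ 1 * |ϑ| +
            |e| / ((bandBounds (show (-4 : ℝ) < -1.1 by norm_num) (show (-1.1 : ℝ) ≤ -0.1 by norm_num) (show (-0.1 : ℝ) < 0 by norm_num)).Dtmin - 2 * A) +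
            msD A₃ A₄ 1 * φ₀) * msD A₃ A₄ 1 ^ 2 +
        K₂ * (radialRowOneConst A ((bandBounds (show (-4 : ℝ) < -1.1 by norm_num) (show (-1.1 : ℝ) ≤ -0.1 by norm_num) (show (-0.1 : ℝ) < 0 by norm_num)).Dtmin - 2 * A) * |e| +
            msD A₃ A₄ 2 * φ₀) * (msD A₃ A₄ 1 + msD A₃ A₄ 1) +
        K₂ * (|ρ| / ((bandBounds (show (-4 : ℝ) < -1.1 by norm_num) (show (-1.1 : ℝ) ≤ -0.1 by norm_num) (show (-0.1 : ℝ) < 0 by norm_num)).Dtmin - 2 * A) +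
              msD A₃ A₄ 1 * |ϑ| +
            |e| / ((bandBounds (show (-4 : ℝ) < -1.1 by norm_num) (show (-1.1 : ℝ) ≤ -0.1 by norm_num) (show (-0.1 : ℝ) < 0 by norm_num)).Dtmin - 2 * A) +
            msD A₃ A₄ 1 * φ₀) * msD A₃ A₄ 2 +
        K₁ * ((uRowTwoConst A A₃ ((bandBounds (show (-4 : ℝ) < -1.1 by norm_num) (show (-1.1 : ℝ) ≤ -0.1 by norm_num) (show (-0.1 : ℝ) < 0 by norm_num)).Dtmin - 2 * A) +
              1 / ((bandBounds (show (-4 : ℝ) < -1.1 by norm_num) (show (-1.1 : ℝ) ≤ -0.1 by norm_num) (show (-0.1 : ℝ) < 0 by norm_num)).Dtmin - 2 * A) +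
              2 * (radialRowOneConst A ((bandBounds (show (-4 : ℝ) < -1.1 by norm_num) (show (-1.1 : ℝ) ≤ -0.1 by norm_num) (show (-0.1 : ℝ) < 0 by norm_num)).Dtmin - 2 * A) -
                1 / ((bandBounds (show (-4 : ℝ) < -1.1 by norm_num) (show (-1.1 : ℝ) ≤ -0.1 by norm_num) (show (-0.1 : ℝ) < 0 by norm_num)).Dtmin - 2 * A))) * |e| +
            msD A₃ A₄ 3 * φ₀) ≤
      3 / 200 * (bandBounds (show (-4 : ℝ) < -1.1 by norm_num) (show (-1.1 : ℝ) ≤ -0.1 by norm_num) (show (-0.1 : ℝ) < 0 by norm_num)).umin ^ 2) :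
    ∀ φ ∈ Icc (-φ₀) φ₀, 2 * (3 / 400 * (bandBounds (show (-4 : ℝ) < -1.1 by norm_num) (show (-1.1 : ℝ) ≤ -0.1 by norm_num) (show (-0.1 : ℝ) < 0 by norm_num)).umin ^ 2) ≤
      iteratedDeriv 2 (fun x : ℝ => frameLevel μ K (pairSumPath μ K ρ ϑ θ 0 - levelPoint μ K e (x + θ))) φ := by
  intro φ hφ
  have hφ' : |φ| ≤ φ₀ := abs_le.2 ⟨hφ.1, hφ.2⟩
  have h1 := iteratedDeriv_two_partnerBand_pp_angle_ge hA hA20 hd hr hlo hhi hA₃ hA₄ hK₁ hK₂ hK₃ hF hρ he ϑ θ φ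
  have h2 := curvFloorErr_mono hA hA20 hd hlo hhi hA₃ hA₄ hK₁ hK₂ hK₃
    (δ₀ := |ρ| / ((bandBounds (show (-4 : ℝ) < -1.1 by norm_num) (show (-1.1 : ℝ) ≤ -0.1 by norm_num) (show (-0.1 : ℝ) < 0 by norm_num)).Dtmin - 2 * A) +
      msD A₃ A₄ 1 * |ϑ|) hφ' he
  linarith

/-- **THE ph PARTNER BAND IS A C² FOLD ON THE `2k_F` WINDOW** (`|ϑ − π|` in place of `|ϑ|`). -/
theorem partnerBand_ph_fold_conv {R : RenConsts} {U : ℝ} {N : ℕ} (hF : FrameOK R U N μ K) {ρ : ℝ} (hρ : |ρ| < r) {e : ℝ} (he : |e| < r) (ϑ θ : ℝ) {φ₀ : ℝ}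
    (hwin : K₃ * (|ρ| / ((bandBounds (show (-4 : ℝ) < -1.1 by norm_num) (show (-1.1 : ℝ) ≤ -0.1 by norm_num) (show (-0.1 : ℝ) < 0 by norm_num)).Dtmin - 2 * A) +
              msD A₃ A₄ 1 * |ϑ - π| +
            |e| / ((bandBounds (show (-4 : ℝ) < -1.1 by norm_num) (show (-1.1 : ℝ) ≤ -0.1 by norm_num) (show (-0.1 : ℝ) < 0 by norm_num)).Dtmin - 2 * A) +
            msD A₃ A₄ 1 * φ₀) * msD A₃ A₄ 1 ^ 2 +
        K₂ * (radialRowOneConst A ((bandBounds (show (-4 : ℝ) < -1.1 by norm_num) (show (-1.1 : ℝ) ≤ -0.1 by norm_num) (show (-0.1 : ℝ) < 0 by norm_num)).Dtmin - 2 * A) * |e| +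
            msD A₃ A₄ 2 * φ₀) * (msD A₃ A₄ 1 + msD A₃ A₄ 1) +
        K₂ * (|ρ| / ((bandBounds (show (-4 : ℝ) < -1.1 by norm_num) (show (-1.1 : ℝ) ≤ -0.1 by norm_num) (show (-0.1 : ℝ) < 0 by norm_num)).Dtmin - 2 * A) +
              msD A₃ A₄ 1 * |ϑ - π| +
            |e| / ((bandBounds (show (-4 : ℝ) < -1.1 by norm_num) (show (-1.1 : ℝ) ≤ -0.1 by norm_num) (show (-0.1 : ℝ) < 0 by norm_num)).Dtmin - 2 * A) +
            msD A₃ A₄ 1 * φ₀) * msD A₃ A₄ 2 +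
        K₁ * ((uRowTwoConst A A₃ ((bandBounds (show (-4 : ℝ) < -1.1 by norm_num) (show (-1.1 : ℝ) ≤ -0.1 by norm_num) (show (-0.1 : ℝ) < 0 by norm_num)).Dtmin - 2 * A) +
              1 / ((bandBounds (show (-4 : ℝ) < -1.1 by norm_num) (show (-1.1 : ℝ) ≤ -0.1 by norm_num) (show (-0.1 : ℝ) < 0 by norm_num)).Dtmin - 2 * A) +
              2 * (radialRowOneConst A ((bandBounds (show (-4 : ℝ) < -1.1 by norm_num) (show (-1.1 : ℝ) ≤ -0.1 by norm_num) (show (-0.1 : ℝ) < 0 by norm_num)).Dtmin - 2 * A) -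
                1 / ((bandBounds (show (-4 : ℝ) < -1.1 by norm_num) (show (-1.1 : ℝ) ≤ -0.1 by norm_num) (show (-0.1 : ℝ) < 0 by norm_num)).Dtmin - 2 * A))) * |e| +
            msD A₃ A₄ 3 * φ₀) ≤
      3 / 200 * (bandBounds (show (-4 : ℝ) < -1.1 by norm_num) (show (-1.1 : ℝ) ≤ -0.1 by norm_num) (show (-0.1 : ℝ) < 0 by norm_num)).umin ^ 2) :
    ∀ φ ∈ Icc (-φ₀) φ₀, 2 * (3 / 400 * (bandBounds (show (-4 : ℝ) < -1.1 by norm_num) (show (-1.1 : ℝ) ≤ -0.1 by norm_num) (show (-0.1 : ℝ) < 0 by norm_num)).umin ^ 2) ≤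
      iteratedDeriv 2 (fun x : ℝ => frameLevel μ K (levelPoint μ K e (x + θ) - pairDiffPath μ K ρ ϑ θ 0)) φ := by
  intro φ hφ
  have hφ' : |φ| ≤ φ₀ := abs_le.2 ⟨hφ.1, hφ.2⟩
  have h1 := iteratedDeriv_two_partnerBand_ph_angle_ge hA hA20 hd hr hlo hhi hA₃ hA₄ hK₁ hK₂ hK₃ hF hρ he ϑ θ φ
  have h2 := curvFloorErr_mono hA hA20 hd hlo hhi hA₃ hA₄ hK₁ hK₂ hK₃
    (δ₀ := |ρ| / ((bandBounds (show (-4 : ℝ) < -1.1 by norm_num) (show (-1.1 : ℝ) ≤ -0.1 by norm_num) (show (-0.1 : ℝ) < 0 by norm_num)).Dtmin - 2 * A) +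
      msD A₃ A₄ 1 * |ϑ - π|) hφ' he
  linarith

end Sizes

/-! ## The sharp laws by name (the fold package `g ∈ C²`, `2b ≤ g″` is all that parts 2–3 consume) -/

section Sharp

variable {g : ℝ → ℝ} {b φ₀ : ℝ}

/-- **LEVEL-SET LAW ON A SYMMETRIC WINDOW from the fold package**: `g ∈ C²`, `2b ≤ g″` on `[−φ₀, φ₀]` (`0 < b`, `0 ≤ φ₀`), `y₁ ≤ y₂` ⟹
`vol {φ ∈ [−φ₀, φ₀] : g φ ∈ [y₁, y₂]} ≤ 2·√((y₂ − y₁)/b)` (the minimiser is produced internally). [folklore] -/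
theorem volume_levelSet_le_of_fold_conv (hg : ContDiff ℝ 2 g) (hb : 0 < b) (hφ₀ : 0 ≤ φ₀) (hconv : ∀ t ∈ Icc (-φ₀) φ₀, 2 * b ≤ iteratedDeriv 2 g t)
    {y₁ y₂ : ℝ} (hy : y₁ ≤ y₂) :
    volume {φ : ℝ | φ ∈ Icc (-φ₀) φ₀ ∧ g φ ∈ Icc y₁ y₂} ≤ ENNReal.ofReal (2 * Real.sqrt ((y₂ - y₁) / b)) := by
  obtain ⟨c, hc, hmin⟩ := exists_fold_min hg.continuous (by linarith : -φ₀ ≤ φ₀)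
  exact volume_fold_levelSet_le_sqrt_sub hg hb hconv hc hmin hy

/-- **WINDOW TERM IN LEVEL CURRENCY from the fold package**: there is a minimiser `c ∈ [−φ₀, φ₀]` of `g` with
`‖∫_{−φ₀..φ₀} w φ • Ψ(g φ) dφ‖ ≤ W·(2√b)⁻¹·(∫_{g c..g(−φ₀)} + ∫_{g c..g φ₀}) ‖Ψ y‖ (y − g c)^{−1/2} dy`. [folklore] -/
theorem norm_intervalIntegral_smul_comp_le_level_of_fold_conv (hg : ContDiff ℝ 2 g) (hb : 0 < b) (hφ₀ : 0 ≤ φ₀)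
    (hconv : ∀ t ∈ Icc (-φ₀) φ₀, 2 * b ≤ iteratedDeriv 2 g t) {w : ℝ → ℝ} {W : ℝ} (hw : ∀ φ ∈ Icc (-φ₀) φ₀, |w φ| ≤ W) (hW : 0 ≤ W)
    {Ψ : ℝ → E} (hΨ : Continuous Ψ) :
    ∃ c ∈ Icc (-φ₀) φ₀, (∀ t ∈ Icc (-φ₀) φ₀, g c ≤ g t) ∧
      ‖∫ φ in -φ₀..φ₀, w φ • Ψ (g φ)‖ ≤ W * ((2 * Real.sqrt b)⁻¹ *
        ((∫ y in g c..g (-φ₀), ‖Ψ y‖ * (y - g c) ^ (-(1 / 2 : ℝ))) + ∫ y in g c..g φ₀, ‖Ψ y‖ * (y - g c) ^ (-(1 / 2 : ℝ)))) := by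
  obtain ⟨c, hc, hmin⟩ := exists_fold_min hg.continuous (by linarith : -φ₀ ≤ φ₀)
  exact ⟨c, hc, hmin, norm_intervalIntegral_smul_comp_le_fold_level hg hb hconv hc hmin hw hW hΨ⟩

end Sharp

section SharpSizes

variable {K : TrigPolyC4v} {A : ℝ} (hA : ∀ p : Momentum, ∀ j ≤ 2, ‖iteratedFDeriv ℝ j (frameShift K) p‖ ≤ A) (hA20 : A ≤ 1 / 20)
  (hd : klCurveD ≤ (bandBounds (show (-4 : ℝ) < -1.1 by norm_num) (show (-1.1 : ℝ) ≤ -0.1 by norm_num)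
    (show (-0.1 : ℝ) < 0 by norm_num)).Dtmin - 2 * A)
  {μ r : ℝ} (hr : 0 < r) (hlo : (-1.1 : ℝ) < μ - r - A) (hhi : μ + r + A < -0.1)
  {A₃ A₄ : ℝ} (hA₃ : ∀ p : Momentum, ‖iteratedFDeriv ℝ 3 (frameShift K) p‖ ≤ A₃)
  (hA₄ : ∀ p : Momentum, ‖iteratedFDeriv ℝ 4 (frameShift K) p‖ ≤ A₄)
  {K₁ K₂ K₃ : ℝ} (hK₁ : ∀ p : Momentum, ‖fderiv ℝ (frameLevel μ K) p‖ ≤ K₁) (hK₂ : ∀ p : Momentum, ‖iteratedFDeriv ℝ 2 (frameLevel μ K) p‖ ≤ K₂)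
  (hK₃ : ∀ p : Momentum, ‖iteratedFDeriv ℝ 3 (frameLevel μ K) p‖ ≤ K₃)
include hA hA20 hd hr hlo hhi hA₃ hA₄ hK₁ hK₂ hK₃

/-- **THE SQUARE-ROOT LAW FOR THE pp PARTNER BAND ON THE TANGENCY WINDOW**: under `FrameOK` and the window condition `L(φ₀) ≤ (3/200)u_min²` (`0 ≤ φ₀`), for
`y₁ ≤ y₂`: `vol {φ ∈ [−φ₀, φ₀] : e_K(S_{ρϑθ}(0) − Φ(e,φ+θ)) ∈ [y₁, y₂]} ≤ 2·√((y₂ − y₁)/((3/400)·u_min²))`. -/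
theorem volume_levelSet_pp_tangency_le {R : RenConsts} {U : ℝ} {N : ℕ} (hF : FrameOK R U N μ K) {ρ : ℝ} (hρ : |ρ| < r) {e : ℝ} (he : |e| < r) (ϑ θ : ℝ)
    {φ₀ : ℝ} (hφ₀ : 0 ≤ φ₀)
    (hwin : K₃ * (|ρ| / ((bandBounds (show (-4 : ℝ) < -1.1 by norm_num) (show (-1.1 : ℝ) ≤ -0.1 by norm_num) (show (-0.1 : ℝ) < 0 by norm_num)).Dtmin - 2 * A) +
              msD A₃ A₄ 1 * |ϑ| +
            |e| / ((bandBounds (show (-4 : ℝ) < -1.1 by norm_num) (show (-1.1 : ℝ) ≤ -0.1 by norm_num) (show (-0.1 : ℝ) < 0 by norm_num)).Dtmin - 2 * A) +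
            msD A₃ A₄ 1 * φ₀) * msD A₃ A₄ 1 ^ 2 +
        K₂ * (radialRowOneConst A ((bandBounds (show (-4 : ℝ) < -1.1 by norm_num) (show (-1.1 : ℝ) ≤ -0.1 by norm_num) (show (-0.1 : ℝ) < 0 by norm_num)).Dtmin - 2 * A) * |e| +
            msD A₃ A₄ 2 * φ₀) * (msD A₃ A₄ 1 + msD A₃ A₄ 1) +
        K₂ * (|ρ| / ((bandBounds (show (-4 : ℝ) < -1.1 by norm_num) (show (-1.1 : ℝ) ≤ -0.1 by norm_num) (show (-0.1 : ℝ) < 0 by norm_num)).Dtmin - 2 * A) +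
              msD A₃ A₄ 1 * |ϑ| +
            |e| / ((bandBounds (show (-4 : ℝ) < -1.1 by norm_num) (show (-1.1 : ℝ) ≤ -0.1 by norm_num) (show (-0.1 : ℝ) < 0 by norm_num)).Dtmin - 2 * A) +
            msD A₃ A₄ 1 * φ₀) * msD A₃ A₄ 2 +
        K₁ * ((uRowTwoConst A A₃ ((bandBounds (show (-4 : ℝ) < -1.1 by norm_num) (show (-1.1 : ℝ) ≤ -0.1 by norm_num) (show (-0.1 : ℝ) < 0 by norm_num)).Dtmin - 2 * A) +
              1 / ((bandBounds (show (-4 : ℝ) < -1.1 by norm_num) (show (-1.1 : ℝ) ≤ -0.1 by norm_num) (show (-0.1 : ℝ) < 0 by norm_num)).Dtmin - 2 * A) +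
              2 * (radialRowOneConst A ((bandBounds (show (-4 : ℝ) < -1.1 by norm_num) (show (-1.1 : ℝ) ≤ -0.1 by norm_num) (show (-0.1 : ℝ) < 0 by norm_num)).Dtmin - 2 * A) -
                1 / ((bandBounds (show (-4 : ℝ) < -1.1 by norm_num) (show (-1.1 : ℝ) ≤ -0.1 by norm_num) (show (-0.1 : ℝ) < 0 by norm_num)).Dtmin - 2 * A))) * |e| +
            msD A₃ A₄ 3 * φ₀) ≤
      3 / 200 * (bandBounds (show (-4 : ℝ) < -1.1 by norm_num) (show (-1.1 : ℝ) ≤ -0.1 by norm_num) (show (-0.1 : ℝ) < 0 by norm_num)).umin ^ 2)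
    {y₁ y₂ : ℝ} (hy : y₁ ≤ y₂) :
    volume {φ : ℝ | φ ∈ Icc (-φ₀) φ₀ ∧ frameLevel μ K (pairSumPath μ K ρ ϑ θ 0 - levelPoint μ K e (φ + θ)) ∈ Icc y₁ y₂} ≤
      ENNReal.ofReal (2 * Real.sqrt ((y₂ - y₁) / (3 / 400 * (bandBounds (show (-4 : ℝ) < -1.1 by norm_num) (show (-1.1 : ℝ) ≤ -0.1 by norm_num) (show (-0.1 : ℝ) < 0 by norm_num)).umin ^ 2))) := by
  have hu := (bandBounds (show (-4 : ℝ) < -1.1 by norm_num) (show (-1.1 : ℝ) ≤ -0.1 by norm_num) (show (-0.1 : ℝ) < 0 by norm_num)).umin_pos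
  exact volume_levelSet_le_of_fold_conv (g := fun x : ℝ => frameLevel μ K (pairSumPath μ K ρ ϑ θ 0 - levelPoint μ K e (x + θ)))
    (contDiff_partnerBand_angle hA hd hlo hhi _ he θ) (by positivity) hφ₀
    (partnerBand_pp_fold_conv hA hA20 hd hr hlo hhi hA₃ hA₄ hK₁ hK₂ hK₃ hF hρ he ϑ θ hwin) hy

/-- **THE SQUARE-ROOT LAW FOR THE ph PARTNER BAND ON THE `2k_F` WINDOW**. -/
theorem volume_levelSet_ph_tangency_le {R : RenConsts} {U : ℝ} {N : ℕ} (hF : FrameOK R U N μ K) {ρ : ℝ} (hρ : |ρ| < r) {e : ℝ} (he : |e| < r) (ϑ θ : ℝ)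
    {φ₀ : ℝ} (hφ₀ : 0 ≤ φ₀)
    (hwin : K₃ * (|ρ| / ((bandBounds (show (-4 : ℝ) < -1.1 by norm_num) (show (-1.1 : ℝ) ≤ -0.1 by norm_num) (show (-0.1 : ℝ) < 0 by norm_num)).Dtmin - 2 * A) +
              msD A₃ A₄ 1 * |ϑ - π| +
            |e| / ((bandBounds (show (-4 : ℝ) < -1.1 by norm_num) (show (-1.1 : ℝ) ≤ -0.1 by norm_num) (show (-0.1 : ℝ) < 0 by norm_num)).Dtmin - 2 * A) +
            msD A₃ A₄ 1 * φ₀) * msD A₃ A₄ 1 ^ 2 +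
        K₂ * (radialRowOneConst A ((bandBounds (show (-4 : ℝ) < -1.1 by norm_num) (show (-1.1 : ℝ) ≤ -0.1 by norm_num) (show (-0.1 : ℝ) < 0 by norm_num)).Dtmin - 2 * A) * |e| +
            msD A₃ A₄ 2 * φ₀) * (msD A₃ A₄ 1 + msD A₃ A₄ 1) +
        K₂ * (|ρ| / ((bandBounds (show (-4 : ℝ) < -1.1 by norm_num) (show (-1.1 : ℝ) ≤ -0.1 by norm_num) (show (-0.1 : ℝ) < 0 by norm_num)).Dtmin - 2 * A) +
              msD A₃ A₄ 1 * |ϑ - π| +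
            |e| / ((bandBounds (show (-4 : ℝ) < -1.1 by norm_num) (show (-1.1 : ℝ) ≤ -0.1 by norm_num) (show (-0.1 : ℝ) < 0 by norm_num)).Dtmin - 2 * A) +
            msD A₃ A₄ 1 * φ₀) * msD A₃ A₄ 2 +
        K₁ * ((uRowTwoConst A A₃ ((bandBounds (show (-4 : ℝ) < -1.1 by norm_num) (show (-1.1 : ℝ) ≤ -0.1 by norm_num) (show (-0.1 : ℝ) < 0 by norm_num)).Dtmin - 2 * A) +
              1 / ((bandBounds (show (-4 : ℝ) < -1.1 by norm_num) (show (-1.1 : ℝ) ≤ -0.1 by norm_num) (show (-0.1 : ℝ) < 0 by norm_num)).Dtmin - 2 * A) +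
              2 * (radialRowOneConst A ((bandBounds (show (-4 : ℝ) < -1.1 by norm_num) (show (-1.1 : ℝ) ≤ -0.1 by norm_num) (show (-0.1 : ℝ) < 0 by norm_num)).Dtmin - 2 * A) -
                1 / ((bandBounds (show (-4 : ℝ) < -1.1 by norm_num) (show (-1.1 : ℝ) ≤ -0.1 by norm_num) (show (-0.1 : ℝ) < 0 by norm_num)).Dtmin - 2 * A))) * |e| +
            msD A₃ A₄ 3 * φ₀) ≤
      3 / 200 * (bandBounds (show (-4 : ℝ) < -1.1 by norm_num) (show (-1.1 : ℝ) ≤ -0.1 by norm_num) (show (-0.1 : ℝ) < 0 by norm_num)).umin ^ 2)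
    {y₁ y₂ : ℝ} (hy : y₁ ≤ y₂) :
    volume {φ : ℝ | φ ∈ Icc (-φ₀) φ₀ ∧ frameLevel μ K (levelPoint μ K e (φ + θ) - pairDiffPath μ K ρ ϑ θ 0) ∈ Icc y₁ y₂} ≤
      ENNReal.ofReal (2 * Real.sqrt ((y₂ - y₁) / (3 / 400 * (bandBounds (show (-4 : ℝ) < -1.1 by norm_num) (show (-1.1 : ℝ) ≤ -0.1 by norm_num) (show (-0.1 : ℝ) < 0 by norm_num)).umin ^ 2))) := by
  have hu := (bandBounds (show (-4 : ℝ) < -1.1 by norm_num) (show (-1.1 : ℝ) ≤ -0.1 by norm_num) (show (-0.1 : ℝ) < 0 by norm_num)).umin_pos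
  have hflip : (fun x : ℝ => frameLevel μ K (levelPoint μ K e (x + θ) - pairDiffPath μ K ρ ϑ θ 0)) =
      fun x : ℝ => frameLevel μ K (pairDiffPath μ K ρ ϑ θ 0 - levelPoint μ K e (x + θ)) := by
    funext x
    rw [show levelPoint μ K e (x + θ) - pairDiffPath μ K ρ ϑ θ 0 = -(pairDiffPath μ K ρ ϑ θ 0 - levelPoint μ K e (x + θ)) by abel, frameLevel_neg]
  have hC : ContDiff ℝ 2 (fun x : ℝ => frameLevel μ K (levelPoint μ K e (x + θ) - pairDiffPath μ K ρ ϑ θ 0)) := by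
    rw [hflip]; exact contDiff_partnerBand_angle hA hd hlo hhi _ he θ
  exact volume_levelSet_le_of_fold_conv (g := fun x : ℝ => frameLevel μ K (levelPoint μ K e (x + θ) - pairDiffPath μ K ρ ϑ θ 0)) hC (by positivity) hφ₀
    (partnerBand_ph_fold_conv hA hA20 hd hr hlo hhi hA₃ hA₄ hK₁ hK₂ hK₃ hF hρ he ϑ θ hwin) hy

end SharpSizes

/-! ## The window term in level currency, by name (bullet 3 of the module docstring; referee note B-g42bx, gen 22) -/

section SharpSizesLevel

variable {K : TrigPolyC4v} {A : ℝ} (hA : ∀ p : Momentum, ∀ j ≤ 2, ‖iteratedFDeriv ℝ j (frameShift K) p‖ ≤ A) (hA20 : A ≤ 1 / 20)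
  (hd : klCurveD ≤ (bandBounds (show (-4 : ℝ) < -1.1 by norm_num) (show (-1.1 : ℝ) ≤ -0.1 by norm_num)
    (show (-0.1 : ℝ) < 0 by norm_num)).Dtmin - 2 * A)
  {μ r : ℝ} (hr : 0 < r) (hlo : (-1.1 : ℝ) < μ - r - A) (hhi : μ + r + A < -0.1)
  {A₃ A₄ : ℝ} (hA₃ : ∀ p : Momentum, ‖iteratedFDeriv ℝ 3 (frameShift K) p‖ ≤ A₃)
  (hA₄ : ∀ p : Momentum, ‖iteratedFDeriv ℝ 4 (frameShift K) p‖ ≤ A₄)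
  {K₁ K₂ K₃ : ℝ} (hK₁ : ∀ p : Momentum, ‖fderiv ℝ (frameLevel μ K) p‖ ≤ K₁) (hK₂ : ∀ p : Momentum, ‖iteratedFDeriv ℝ 2 (frameLevel μ K) p‖ ≤ K₂)
  (hK₃ : ∀ p : Momentum, ‖iteratedFDeriv ℝ 3 (frameLevel μ K) p‖ ≤ K₃)
include hA hA20 hd hr hlo hhi hA₃ hA₄ hK₁ hK₂ hK₃

/-- **THE WINDOW TERM OF THE pp PARTNER BAND IN LEVEL CURRENCY**: under `FrameOK` and the window condition `L(φ₀) ≤ (3/200)u_min²` (`0 ≤ φ₀`), for a weight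
`|w| ≤ W` on `[−φ₀, φ₀]` and continuous `Ψ : ℝ → E` there is a minimiser `c ∈ [−φ₀, φ₀]` of `ē(φ) = e_K(S_{ρϑθ}(0) − Φ(e,φ+θ))` on the window with
`‖∫_{−φ₀..φ₀} w φ • Ψ(ē φ) dφ‖ ≤ W·(2√b)⁻¹·(∫_{ē c..ē(−φ₀)} + ∫_{ē c..ē φ₀}) ‖Ψ y‖·(y − ē c)^{−1/2} dy`, `b = (3/400)·u_min²`. -/
theorem norm_intervalIntegral_smul_partnerBand_pp_tangency_le_level {R : RenConsts} {U : ℝ} {N : ℕ} (hF : FrameOK R U N μ K) {ρ : ℝ} (hρ : |ρ| < r)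
    {e : ℝ} (he : |e| < r) (ϑ θ : ℝ) {φ₀ : ℝ} (hφ₀ : 0 ≤ φ₀)
    (hwin : K₃ * (|ρ| / ((bandBounds (show (-4 : ℝ) < -1.1 by norm_num) (show (-1.1 : ℝ) ≤ -0.1 by norm_num) (show (-0.1 : ℝ) < 0 by norm_num)).Dtmin - 2 * A) +
              msD A₃ A₄ 1 * |ϑ| +
            |e| / ((bandBounds (show (-4 : ℝ) < -1.1 by norm_num) (show (-1.1 : ℝ) ≤ -0.1 by norm_num) (show (-0.1 : ℝ) < 0 by norm_num)).Dtmin - 2 * A) +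
            msD A₃ A₄ 1 * φ₀) * msD A₃ A₄ 1 ^ 2 +
        K₂ * (radialRowOneConst A ((bandBounds (show (-4 : ℝ) < -1.1 by norm_num) (show (-1.1 : ℝ) ≤ -0.1 by norm_num) (show (-0.1 : ℝ) < 0 by norm_num)).Dtmin - 2 * A) * |e| +
            msD A₃ A₄ 2 * φ₀) * (msD A₃ A₄ 1 + msD A₃ A₄ 1) +
        K₂ * (|ρ| / ((bandBounds (show (-4 : ℝ) < -1.1 by norm_num) (show (-1.1 : ℝ) ≤ -0.1 by norm_num) (show (-0.1 : ℝ) < 0 by norm_num)).Dtmin - 2 * A) +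
              msD A₃ A₄ 1 * |ϑ| +
            |e| / ((bandBounds (show (-4 : ℝ) < -1.1 by norm_num) (show (-1.1 : ℝ) ≤ -0.1 by norm_num) (show (-0.1 : ℝ) < 0 by norm_num)).Dtmin - 2 * A) +
            msD A₃ A₄ 1 * φ₀) * msD A₃ A₄ 2 +
        K₁ * ((uRowTwoConst A A₃ ((bandBounds (show (-4 : ℝ) < -1.1 by norm_num) (show (-1.1 : ℝ) ≤ -0.1 by norm_num) (show (-0.1 : ℝ) < 0 by norm_num)).Dtmin - 2 * A) +
              1 / ((bandBounds (show (-4 : ℝ) < -1.1 by norm_num) (show (-1.1 : ℝ) ≤ -0.1 by norm_num) (show (-0.1 : ℝ) < 0 by norm_num)).Dtmin - 2 * A) +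
              2 * (radialRowOneConst A ((bandBounds (show (-4 : ℝ) < -1.1 by norm_num) (show (-1.1 : ℝ) ≤ -0.1 by norm_num) (show (-0.1 : ℝ) < 0 by norm_num)).Dtmin - 2 * A) -
                1 / ((bandBounds (show (-4 : ℝ) < -1.1 by norm_num) (show (-1.1 : ℝ) ≤ -0.1 by norm_num) (show (-0.1 : ℝ) < 0 by norm_num)).Dtmin - 2 * A))) * |e| +
            msD A₃ A₄ 3 * φ₀) ≤
      3 / 200 * (bandBounds (show (-4 : ℝ) < -1.1 by norm_num) (show (-1.1 : ℝ) ≤ -0.1 by norm_num) (show (-0.1 : ℝ) < 0 by norm_num)).umin ^ 2)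
    {w : ℝ → ℝ} {W : ℝ} (hw : ∀ φ ∈ Icc (-φ₀) φ₀, |w φ| ≤ W) (hW : 0 ≤ W) {Ψ : ℝ → E} (hΨ : Continuous Ψ) :
    ∃ c ∈ Icc (-φ₀) φ₀,
      (∀ t ∈ Icc (-φ₀) φ₀, frameLevel μ K (pairSumPath μ K ρ ϑ θ 0 - levelPoint μ K e (c + θ)) ≤
          frameLevel μ K (pairSumPath μ K ρ ϑ θ 0 - levelPoint μ K e (t + θ))) ∧
        ‖∫ φ in -φ₀..φ₀, w φ • Ψ (frameLevel μ K (pairSumPath μ K ρ ϑ θ 0 - levelPoint μ K e (φ + θ)))‖ ≤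
          W * ((2 * Real.sqrt (3 / 400 * (bandBounds (show (-4 : ℝ) < -1.1 by norm_num) (show (-1.1 : ℝ) ≤ -0.1 by norm_num) (show (-0.1 : ℝ) < 0 by norm_num)).umin ^ 2))⁻¹ *
            ((∫ y in frameLevel μ K (pairSumPath μ K ρ ϑ θ 0 - levelPoint μ K e (c + θ))..frameLevel μ K
                  (pairSumPath μ K ρ ϑ θ 0 - levelPoint μ K e (-φ₀ + θ)),
                ‖Ψ y‖ * (y - frameLevel μ K (pairSumPath μ K ρ ϑ θ 0 - levelPoint μ K e (c + θ))) ^ (-(1 / 2 : ℝ))) +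
              ∫ y in frameLevel μ K (pairSumPath μ K ρ ϑ θ 0 - levelPoint μ K e (c + θ))..frameLevel μ K
                  (pairSumPath μ K ρ ϑ θ 0 - levelPoint μ K e (φ₀ + θ)),
                ‖Ψ y‖ * (y - frameLevel μ K (pairSumPath μ K ρ ϑ θ 0 - levelPoint μ K e (c + θ))) ^ (-(1 / 2 : ℝ)))) := by
  have hu := (bandBounds (show (-4 : ℝ) < -1.1 by norm_num) (show (-1.1 : ℝ) ≤ -0.1 by norm_num) (show (-0.1 : ℝ) < 0 by norm_num)).umin_pos
  exact norm_intervalIntegral_smul_comp_le_level_of_fold_conv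
    (g := fun x : ℝ => frameLevel μ K (pairSumPath μ K ρ ϑ θ 0 - levelPoint μ K e (x + θ)))
    (contDiff_partnerBand_angle hA hd hlo hhi _ he θ) (by positivity) hφ₀
    (partnerBand_pp_fold_conv hA hA20 hd hr hlo hhi hA₃ hA₄ hK₁ hK₂ hK₃ hF hρ he ϑ θ hwin) hw hW hΨ

/-- **THE WINDOW TERM OF THE ph PARTNER BAND IN LEVEL CURRENCY** (`ē(φ) = e_K(Φ(e,φ+θ) − D_{ρϑθ}(0))`, `|ϑ − π|` in place of `|ϑ|`). -/
theorem norm_intervalIntegral_smul_partnerBand_ph_tangency_le_level {R : RenConsts} {U : ℝ} {N : ℕ} (hF : FrameOK R U N μ K) {ρ : ℝ} (hρ : |ρ| < r)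
    {e : ℝ} (he : |e| < r) (ϑ θ : ℝ) {φ₀ : ℝ} (hφ₀ : 0 ≤ φ₀)
    (hwin : K₃ * (|ρ| / ((bandBounds (show (-4 : ℝ) < -1.1 by norm_num) (show (-1.1 : ℝ) ≤ -0.1 by norm_num) (show (-0.1 : ℝ) < 0 by norm_num)).Dtmin - 2 * A) +
              msD A₃ A₄ 1 * |ϑ - π| +
            |e| / ((bandBounds (show (-4 : ℝ) < -1.1 by norm_num) (show (-1.1 : ℝ) ≤ -0.1 by norm_num) (show (-0.1 : ℝ) < 0 by norm_num)).Dtmin - 2 * A) +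
            msD A₃ A₄ 1 * φ₀) * msD A₃ A₄ 1 ^ 2 +
        K₂ * (radialRowOneConst A ((bandBounds (show (-4 : ℝ) < -1.1 by norm_num) (show (-1.1 : ℝ) ≤ -0.1 by norm_num) (show (-0.1 : ℝ) < 0 by norm_num)).Dtmin - 2 * A) * |e| +
            msD A₃ A₄ 2 * φ₀) * (msD A₃ A₄ 1 + msD A₃ A₄ 1) +
        K₂ * (|ρ| / ((bandBounds (show (-4 : ℝ) < -1.1 by norm_num) (show (-1.1 : ℝ) ≤ -0.1 by norm_num) (show (-0.1 : ℝ) < 0 by norm_num)).Dtmin - 2 * A) +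
              msD A₃ A₄ 1 * |ϑ - π| +
            |e| / ((bandBounds (show (-4 : ℝ) < -1.1 by norm_num) (show (-1.1 : ℝ) ≤ -0.1 by norm_num) (show (-0.1 : ℝ) < 0 by norm_num)).Dtmin - 2 * A) +
            msD A₃ A₄ 1 * φ₀) * msD A₃ A₄ 2 +
        K₁ * ((uRowTwoConst A A₃ ((bandBounds (show (-4 : ℝ) < -1.1 by norm_num) (show (-1.1 : ℝ) ≤ -0.1 by norm_num) (show (-0.1 : ℝ) < 0 by norm_num)).Dtmin - 2 * A) +
              1 / ((bandBounds (show (-4 : ℝ) < -1.1 by norm_num) (show (-1.1 : ℝ) ≤ -0.1 by norm_num) (show (-0.1 : ℝ) < 0 by norm_num)).Dtmin - 2 * A) +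
              2 * (radialRowOneConst A ((bandBounds (show (-4 : ℝ) < -1.1 by norm_num) (show (-1.1 : ℝ) ≤ -0.1 by norm_num) (show (-0.1 : ℝ) < 0 by norm_num)).Dtmin - 2 * A) -
                1 / ((bandBounds (show (-4 : ℝ) < -1.1 by norm_num) (show (-1.1 : ℝ) ≤ -0.1 by norm_num) (show (-0.1 : ℝ) < 0 by norm_num)).Dtmin - 2 * A))) * |e| +
            msD A₃ A₄ 3 * φ₀) ≤
      3 / 200 * (bandBounds (show (-4 : ℝ) < -1.1 by norm_num) (show (-1.1 : ℝ) ≤ -0.1 by norm_num) (show (-0.1 : ℝ) < 0 by norm_num)).umin ^ 2)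
    {w : ℝ → ℝ} {W : ℝ} (hw : ∀ φ ∈ Icc (-φ₀) φ₀, |w φ| ≤ W) (hW : 0 ≤ W) {Ψ : ℝ → E} (hΨ : Continuous Ψ) :
    ∃ c ∈ Icc (-φ₀) φ₀,
      (∀ t ∈ Icc (-φ₀) φ₀, frameLevel μ K (levelPoint μ K e (c + θ) - pairDiffPath μ K ρ ϑ θ 0) ≤
          frameLevel μ K (levelPoint μ K e (t + θ) - pairDiffPath μ K ρ ϑ θ 0)) ∧
        ‖∫ φ in -φ₀..φ₀, w φ • Ψ (frameLevel μ K (levelPoint μ K e (φ + θ) - pairDiffPath μ K ρ ϑ θ 0))‖ ≤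
          W * ((2 * Real.sqrt (3 / 400 * (bandBounds (show (-4 : ℝ) < -1.1 by norm_num) (show (-1.1 : ℝ) ≤ -0.1 by norm_num) (show (-0.1 : ℝ) < 0 by norm_num)).umin ^ 2))⁻¹ *
            ((∫ y in frameLevel μ K (levelPoint μ K e (c + θ) - pairDiffPath μ K ρ ϑ θ 0)..frameLevel μ K
                  (levelPoint μ K e (-φ₀ + θ) - pairDiffPath μ K ρ ϑ θ 0),
                ‖Ψ y‖ * (y - frameLevel μ K (levelPoint μ K e (c + θ) - pairDiffPath μ K ρ ϑ θ 0)) ^ (-(1 / 2 : ℝ))) +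
              ∫ y in frameLevel μ K (levelPoint μ K e (c + θ) - pairDiffPath μ K ρ ϑ θ 0)..frameLevel μ K
                  (levelPoint μ K e (φ₀ + θ) - pairDiffPath μ K ρ ϑ θ 0),
                ‖Ψ y‖ * (y - frameLevel μ K (levelPoint μ K e (c + θ) - pairDiffPath μ K ρ ϑ θ 0)) ^ (-(1 / 2 : ℝ)))) := by
  have hu := (bandBounds (show (-4 : ℝ) < -1.1 by norm_num) (show (-1.1 : ℝ) ≤ -0.1 by norm_num) (show (-0.1 : ℝ) < 0 by norm_num)).umin_pos
  have hflip : (fun x : ℝ => frameLevel μ K (levelPoint μ K e (x + θ) - pairDiffPath μ K ρ ϑ θ 0)) =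
      fun x : ℝ => frameLevel μ K (pairDiffPath μ K ρ ϑ θ 0 - levelPoint μ K e (x + θ)) := by
    funext x
    rw [show levelPoint μ K e (x + θ) - pairDiffPath μ K ρ ϑ θ 0 = -(pairDiffPath μ K ρ ϑ θ 0 - levelPoint μ K e (x + θ)) by abel, frameLevel_neg]
  have hC : ContDiff ℝ 2 (fun x : ℝ => frameLevel μ K (levelPoint μ K e (x + θ) - pairDiffPath μ K ρ ϑ θ 0)) := by
    rw [hflip]; exact contDiff_partnerBand_angle hA hd hlo hhi _ he θ
  exact norm_intervalIntegral_smul_comp_le_level_of_fold_conv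
    (g := fun x : ℝ => frameLevel μ K (levelPoint μ K e (x + θ) - pairDiffPath μ K ρ ϑ θ 0)) hC (by positivity) hφ₀
    (partnerBand_ph_fold_conv hA hA20 hd hr hlo hhi hA₃ hA₄ hK₁ hK₂ hK₃ hF hρ he ϑ θ hwin) hw hW hΨ

end SharpSizesLevel

end Summit.HubbardSuperconductivity.HubbardSuperconductivity.Theorems.C4a

end
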